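import Mathlib
import Summits.NavierStokesRegularity.NavierStokesRegularity.Theorems.LerayQuarterDissipationFiniteDissipationLiouvillePersistenceSeq
import Summits.NavierStokesRegularity.NavierStokesRegularity.Theorems.LerayQuarterDissipationFiniteDissipationLiouvilleLambProductCollar
import HarnessLib

/-!
# Crux `FiniteDissipationLiouville` (stmt-NavierStokesRegularity-22144): THE WINDOW SOCKET —
# violations of an apex criterion RECUR WITH BOUNDED GAPS and FILL A DEFINITE PARABOLIC VOLUME

Theorems file of route `LerayQuarterDissipation` (lead prover g19; `--supports` the crux; sequel of
`…PersistenceSeq`, `…EndpointSchemeApex`, `…LocalBalanceApex`, `…CriticalProductionApex`).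
Navier–Stokes regularity is NOT proved by anything here; no summit is.

Lead g18 turned several pointwise hypotheses into APEX CRITERIA: if the hypothesis holds at every
point of a final slab `[τ, 0) × ℝ³`, the field is not singular at the apex; contrapositively a
singular member VIOLATES the hypothesis at points accumulating at the apex. This file adds one more
compactness step, abstractly, for any such criterion:

* **`exists_window_of_apex_kill`** — THE WINDOW SOCKET (point form). Frame: KNSS-gauge Type-I
  ancient mild fields with constant `C`, the quarter-rate dissipation law with constant `K`, and a
  side class `Q` (scale invariant, closed under the KNSS convergence of `…Compactness.seqLimit`).
  Hypothesis `G V t x` at a space–time point: scale covariant, and VIOLATIONS OF THE LIMIT FORCE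
  VIOLATIONS OF THE APPROXIMANTS (`¬ G W t x ⇒ ∀ᶠ j, ¬ G (u j) t x` along the convergence — the
  violation set is open along KNSS limits), with the apex kill «`G W` on `(−1, 0) × ℝ³ ⇒ W` not
  singular». THEN there is ONE `ε = ε(C, K, Q, G) ∈ (0, 1)` such that every singular member of the
  frame violates `G` at some point of EVERY backward window `[−c², −εc²] × ℝ³`, `c > 0`: the
  violations recur with BOUNDED GAPS in logarithmic time `s = −log(−t)` (gap `≤ |log ε|`), at every
  scale, down to the apex and back to `−∞`.
* **`exists_window_volume_of_apex_kill`** — THE WINDOW SOCKET (volume form). If moreover the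
  violation set `{(t, x) : t < 0, ¬ G U t x}` of every member `U` of the frame is OPEN in `ℝ × ℝ³`,
  there are `ε ∈ (0,1)` and `η > 0` such that for every singular member the violation set meets the
  unit window `[−1, −ε] × ℝ³` in a set of (space–time Lebesgue) VOLUME `≥ η`. Since the frame is
  invariant under the parabolic rescalings `V ↦ V_c`, this is a statement about every window
  `[−c², −εc²]` in rescaled units (volume `≥ η c⁵` there; the change of variables is left to a sequel).
* `exists_window_of_apex_kill_envelope`, `exists_window_volume_of_apex_kill_envelope` — the same
  two sockets on the ENVELOPED frame (`HasTypeIDecay C`, law-free for the user: the enveloped class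
  obeys one law `K(C)`, `…LambProduct.exists_uniform_law_of_envelope`).

Proof (both): if windows `[−1, −ε_j]`, `ε_j → 0`, were violation-free (resp. carried violation
sets of volume `→ 0`) for singular members `u_j` (after rescaling the window to unit scale), a
KNSS-convergent subsequence (`…Compactness.seqLimit`) has a limit `W` in the frame (the law and `Q`
are closed), SINGULAR (`…Compactness.persistent_singularity_seq` — this is where the law is used),
and violation-free on `(−1, 0) × ℝ³`: in the point form because a violation of `W` at `(t, x)`,
`−1 < t < 0`, would be a violation of `u_j` at the same point for all large `j`, inside the window
`[−1, −ε_j]` for all large `j`; in the volume form because a violation of `W` gives an open ball of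
violations of `W`, each point of which is eventually a windowed violation of `u_j`, so the ball is a
countable union (over `N`) of the sets «windowed violation of every `u_j`, `j ≥ N`», each of volume
`≤ inf_j vol = 0` — a null open ball in `ℝ × ℝ³`, absurd. The apex kill then says `W` is not
singular — contradiction.

HONEST FRAMING. One more compactness corollary (ineffective `ε`, `η`) of apex criteria about a
HYPOTHETICAL object (a singular member of the stratum / the critical element of the crux); the
instances (threshold one, local enstrophy balances, critical production) are in the sequel files.
Nothing is removed from the catalogued DSS wall (`∀ c>1 TypeIDSSLiouville c`, NECESSARY for the
crux by `…Hardness`). Nothing here bears on Navier–Stokes regularity.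

References: Koch–Nadirashvili–Seregin–Šverák, Acta Math. 203 (2009) §4 (compactness of the class,
persistence of singularities); folklore (contradiction–compactness).
-/

noncomputable section

set_option linter.dupNamespace false

namespace Summit.NavierStokesRegularity.NavierStokesRegularity.Theorems.FiniteDissipationLiouville.WindowSocket

open MeasureTheory Set Filter Topology Metric Function Real
open scoped ENNReal
open Literature.Analysis Literature.Analysis.FluidPDE
open Summit.NavierStokesRegularity.NavierStokesRegularity.Theorems
open Summit.NavierStokesRegularity.NavierStokesRegularity.Theorems.RecurrentReductionD
open Summit.NavierStokesRegularity.NavierStokesRegularity.Theorems.FiniteDissipationLiouville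
open Summit.NavierStokesRegularity.NavierStokesRegularity.Theorems.FiniteDissipationLiouville.LambProduct

variable {C K : ℝ}

/-- The auxiliary sequence `ε_j = 1/(j+2)` lies in `(0, 1)`. [folklore] -/
theorem eps_seq_mem (j : ℕ) : (0 : ℝ) < 1 / ((j : ℝ) + 2) ∧ 1 / ((j : ℝ) + 2) < 1 := by
  have hj : (0 : ℝ) ≤ j := j.cast_nonneg
  refine ⟨by positivity, ?_⟩
  rw [div_lt_one (by positivity)]
  linarith

/-- Along `ψ → ∞`, `1/(ψ j + 2) → 0`. [folklore] -/
theorem tendsto_eps_seq {ψ : ℕ → ℕ} (hψ : Tendsto ψ atTop atTop) :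
    Tendsto (fun j => (1 : ℝ) / ((ψ j : ℝ) + 2)) atTop (𝓝 0) := by
  have h1 : Tendsto (fun j => ((ψ j : ℕ) : ℝ) + 2) atTop atTop :=
    tendsto_atTop_add_const_right _ _ (tendsto_natCast_atTop_atTop.comp hψ)
  refine h1.inv_tendsto_atTop.congr fun j => ?_
  simp only [one_div, Pi.inv_apply]

/-- **THE WINDOW SOCKET (point form).** See the module docstring: in the frame «`IsTypeIAncientMild C`,
law `K`, side class `Q`», a scale-covariant pointwise hypothesis `G` whose violations pass from KNSS
limits to the approximants and which kills the apex singularity from the final slab `(−1, 0) × ℝ³`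
is violated by every singular member somewhere in EVERY window `[−c², −εc²] × ℝ³`, for ONE
`ε ∈ (0, 1)`. [folklore compactness; cite: KochNadirashviliSereginSverak2009, §4 (arXiv:0709.3599 p. 8)] -/
theorem exists_window_of_apex_kill
    {Q : (ℝ → EuclideanSpace ℝ (Fin 3) → EuclideanSpace ℝ (Fin 3)) → Prop}
    {G : (ℝ → EuclideanSpace ℝ (Fin 3) → EuclideanSpace ℝ (Fin 3)) → ℝ → EuclideanSpace ℝ (Fin 3) → Prop}
    (hQscale : ∀ (V : ℝ → EuclideanSpace ℝ (Fin 3) → EuclideanSpace ℝ (Fin 3)) (c : ℝ), 0 < c →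
      Q V → Q (nsRescale c V))
    (hQclosed : ∀ (u : ℕ → ℝ → EuclideanSpace ℝ (Fin 3) → EuclideanSpace ℝ (Fin 3))
        (W : ℝ → EuclideanSpace ℝ (Fin 3) → EuclideanSpace ℝ (Fin 3)),
      (∀ j, IsTypeIAncientMild C (u j)) → (∀ j, Q (u j)) → IsTypeIAncientMild C W →
      (∀ n : ℕ, TendstoUniformlyOn (fun j z => u j z.1 z.2) (fun z => W z.1 z.2) atTop
        (Icc (-((n : ℝ) + 2)) (-(1 / ((n : ℝ) + 2))) ×ˢ
          closedBall (0 : EuclideanSpace ℝ (Fin 3)) ((n : ℝ) + 2))) →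
      (∀ t < 0, ∀ x, Tendsto (fun j => u j t x) atTop (𝓝 (W t x))) →
      (∀ t < 0, ∀ x, Tendsto (fun j => fderiv ℝ (u j t) x) atTop (𝓝 (fderiv ℝ (W t) x))) →
      Q W)
    (hGscale : ∀ (V : ℝ → EuclideanSpace ℝ (Fin 3) → EuclideanSpace ℝ (Fin 3)) (c t : ℝ)
      (x : EuclideanSpace ℝ (Fin 3)), 0 < c → t < 0 → G V (c ^ 2 * t) (c • x) → G (nsRescale c V) t x)
    (hGev : ∀ (u : ℕ → ℝ → EuclideanSpace ℝ (Fin 3) → EuclideanSpace ℝ (Fin 3))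
        (W : ℝ → EuclideanSpace ℝ (Fin 3) → EuclideanSpace ℝ (Fin 3)),
      (∀ j, IsTypeIAncientMild C (u j)) → IsTypeIAncientMild C W →
      (∀ n : ℕ, TendstoUniformlyOn (fun j z => u j z.1 z.2) (fun z => W z.1 z.2) atTop
        (Icc (-((n : ℝ) + 2)) (-(1 / ((n : ℝ) + 2))) ×ˢ
          closedBall (0 : EuclideanSpace ℝ (Fin 3)) ((n : ℝ) + 2))) →
      (∀ t < 0, ∀ x, Tendsto (fun j => u j t x) atTop (𝓝 (W t x))) →
      (∀ t < 0, ∀ x, Tendsto (fun j => fderiv ℝ (u j t) x) atTop (𝓝 (fderiv ℝ (W t) x))) →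
      ∀ t < 0, ∀ x, ¬ G W t x → ∀ᶠ j in atTop, ¬ G (u j) t x)
    (hkill : ∀ (W : ℝ → EuclideanSpace ℝ (Fin 3) → EuclideanSpace ℝ (Fin 3)),
      IsTypeIAncientMild C W →
      (∀ s : ℝ, s < 0 → ∫⁻ x, ‖fderiv ℝ (W s) x‖ₑ ^ 2 ≤ ENNReal.ofReal (K / Real.sqrt (-s))) →
      Q W → (∀ t : ℝ, -1 < t → t < 0 → ∀ x, G W t x) →
      ¬ (∀ r > 0, ∀ M : ℝ, ∃ t ∈ Ioo (-(r ^ 2)) (0 : ℝ),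
        ∃ x ∈ ball (0 : EuclideanSpace ℝ (Fin 3)) r, M < ‖W t x‖)) :
    ∃ ε : ℝ, 0 < ε ∧ ε < 1 ∧
      ∀ (V : ℝ → EuclideanSpace ℝ (Fin 3) → EuclideanSpace ℝ (Fin 3)), IsTypeIAncientMild C V →
        (∀ s : ℝ, s < 0 → ∫⁻ x, ‖fderiv ℝ (V s) x‖ₑ ^ 2 ≤ ENNReal.ofReal (K / Real.sqrt (-s))) →
        Q V →
        (∀ r > 0, ∀ M : ℝ, ∃ t ∈ Ioo (-(r ^ 2)) (0 : ℝ),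
          ∃ x ∈ ball (0 : EuclideanSpace ℝ (Fin 3)) r, M < ‖V t x‖) →
        ∀ c : ℝ, 0 < c → ∃ t ∈ Icc (-c ^ 2) (-(ε * c ^ 2)), ∃ x : EuclideanSpace ℝ (Fin 3), ¬ G V t x := by
  by_contra hcon
  push Not at hcon
  -- ## unit-scale violation-free windows `[−1, −ε]` for every `ε ∈ (0,1)`
  have hunit : ∀ ε : ℝ, 0 < ε → ε < 1 →
      ∃ u : ℝ → EuclideanSpace ℝ (Fin 3) → EuclideanSpace ℝ (Fin 3), IsTypeIAncientMild C u ∧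
        (∀ s : ℝ, s < 0 → ∫⁻ x, ‖fderiv ℝ (u s) x‖ₑ ^ 2 ≤ ENNReal.ofReal (K / Real.sqrt (-s))) ∧
        Q u ∧
        (∀ r > 0, ∀ M : ℝ, ∃ t ∈ Ioo (-(r ^ 2)) (0 : ℝ),
          ∃ x ∈ ball (0 : EuclideanSpace ℝ (Fin 3)) r, M < ‖u t x‖) ∧
        ∀ t ∈ Icc (-1 : ℝ) (-ε), ∀ x, G u t x := by
    intro ε hε hε1
    obtain ⟨V, hV, hlaw, hQ, hsing, c, hc, hgood⟩ := hcon ε hε hε1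
    refine ⟨nsRescale c V, hV.nsRescale hc, dissipationLaw_nsRescale hlaw hc, hQscale V c hc hQ,
      singularAtOrigin_nsRescale hsing hc, fun t ht x => hGscale V c t x hc (by linarith [ht.2]) ?_⟩
    have hc2 : 0 < c ^ 2 := by positivity
    refine hgood (c ^ 2 * t) ⟨?_, ?_⟩ (c • x)
    · nlinarith [ht.1]
    · nlinarith [ht.2]
  -- ## the sequence `ε_j = 1/(j+2)` and its KNSS limit
  choose u hu hlaw hQu hsu hgood using fun j : ℕ => hunit (1 / ((j : ℝ) + 2)) (eps_seq_mem j).1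
    (eps_seq_mem j).2
  obtain ⟨ψ, hψ, W, hW, hunif, hpt, hgr⟩ := Compactness.seqLimit hu
  have hψt : Tendsto ψ atTop atTop := hψ.tendsto_atTop
  have hlawW := dissipationLaw_of_tendsto_fderiv (w := fun j => u (ψ j)) (fun j => hlaw (ψ j)) hgr
  have hQW : Q W := hQclosed (fun j => u (ψ j)) W (fun j => hu (ψ j)) (fun j => hQu (ψ j)) hW
    hunif hpt hgr
  have hWsing := Compactness.persistent_singularity_seq (w := fun j => u (ψ j))
    (fun j => hu _) (fun j => hlaw _) (fun j => hsu _) hW hunif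
  -- ## the limit is violation-free on `(−1, 0) × ℝ³`
  have hgoodW : ∀ t : ℝ, -1 < t → t < 0 → ∀ x, G W t x := by
    intro t h1 ht x
    by_contra hbad
    have hev := hGev (fun j => u (ψ j)) W (fun j => hu _) hW hunif hpt hgr t ht x hbad
    have hev2 : ∀ᶠ j in atTop, (1 : ℝ) / ((ψ j : ℝ) + 2) < -t :=
      (tendsto_eps_seq hψt).eventually (gt_mem_nhds (neg_pos.2 ht))
    obtain ⟨j, hj1, hj2⟩ := (hev.and hev2).exists
    exact hj1 (hgood (ψ j) t ⟨h1.le, by linarith⟩ x)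
  exact hkill W hW hlawW hQW hgoodW hWsing

/-- The product Lebesgue measure on `ℝ × ℝ³` charges open sets. [folklore] -/
theorem isOpenPosMeasure_volume_prod :
    (volume : Measure (ℝ × EuclideanSpace ℝ (Fin 3))).IsOpenPosMeasure := by
  rw [Measure.volume_eq_prod]
  infer_instance

/-- **THE WINDOW SOCKET (volume form).** As `exists_window_of_apex_kill`, plus: the violation set
`{(t,x) : t < 0, ¬ G U t x}` of every member of the frame is open. THEN there are `ε ∈ (0,1)` and
`η > 0` such that the violation set of every singular member of the frame meets the unit window
`[−1, −ε] × ℝ³` in volume `≥ η` (the frame is scale invariant: apply to `V_c` for the window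
`[−c², −εc²]` of `V`). [folklore compactness; cite: KochNadirashviliSereginSverak2009, §4 (arXiv:0709.3599 p. 8)] -/
theorem exists_window_volume_of_apex_kill
    {Q : (ℝ → EuclideanSpace ℝ (Fin 3) → EuclideanSpace ℝ (Fin 3)) → Prop}
    {G : (ℝ → EuclideanSpace ℝ (Fin 3) → EuclideanSpace ℝ (Fin 3)) → ℝ → EuclideanSpace ℝ (Fin 3) → Prop}
    (hQclosed : ∀ (u : ℕ → ℝ → EuclideanSpace ℝ (Fin 3) → EuclideanSpace ℝ (Fin 3))
        (W : ℝ → EuclideanSpace ℝ (Fin 3) → EuclideanSpace ℝ (Fin 3)),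
      (∀ j, IsTypeIAncientMild C (u j)) → (∀ j, Q (u j)) → IsTypeIAncientMild C W →
      (∀ n : ℕ, TendstoUniformlyOn (fun j z => u j z.1 z.2) (fun z => W z.1 z.2) atTop
        (Icc (-((n : ℝ) + 2)) (-(1 / ((n : ℝ) + 2))) ×ˢ
          closedBall (0 : EuclideanSpace ℝ (Fin 3)) ((n : ℝ) + 2))) →
      (∀ t < 0, ∀ x, Tendsto (fun j => u j t x) atTop (𝓝 (W t x))) →
      (∀ t < 0, ∀ x, Tendsto (fun j => fderiv ℝ (u j t) x) atTop (𝓝 (fderiv ℝ (W t) x))) →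
      Q W)
    (hGev : ∀ (u : ℕ → ℝ → EuclideanSpace ℝ (Fin 3) → EuclideanSpace ℝ (Fin 3))
        (W : ℝ → EuclideanSpace ℝ (Fin 3) → EuclideanSpace ℝ (Fin 3)),
      (∀ j, IsTypeIAncientMild C (u j)) → IsTypeIAncientMild C W →
      (∀ n : ℕ, TendstoUniformlyOn (fun j z => u j z.1 z.2) (fun z => W z.1 z.2) atTop
        (Icc (-((n : ℝ) + 2)) (-(1 / ((n : ℝ) + 2))) ×ˢ
          closedBall (0 : EuclideanSpace ℝ (Fin 3)) ((n : ℝ) + 2))) →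
      (∀ t < 0, ∀ x, Tendsto (fun j => u j t x) atTop (𝓝 (W t x))) →
      (∀ t < 0, ∀ x, Tendsto (fun j => fderiv ℝ (u j t) x) atTop (𝓝 (fderiv ℝ (W t) x))) →
      ∀ t < 0, ∀ x, ¬ G W t x → ∀ᶠ j in atTop, ¬ G (u j) t x)
    (hGopen : ∀ (U : ℝ → EuclideanSpace ℝ (Fin 3) → EuclideanSpace ℝ (Fin 3)),
      IsTypeIAncientMild C U → Q U →
      IsOpen {p : ℝ × EuclideanSpace ℝ (Fin 3) | p.1 < 0 ∧ ¬ G U p.1 p.2})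
    (hkill : ∀ (W : ℝ → EuclideanSpace ℝ (Fin 3) → EuclideanSpace ℝ (Fin 3)),
      IsTypeIAncientMild C W →
      (∀ s : ℝ, s < 0 → ∫⁻ x, ‖fderiv ℝ (W s) x‖ₑ ^ 2 ≤ ENNReal.ofReal (K / Real.sqrt (-s))) →
      Q W → (∀ t : ℝ, -1 < t → t < 0 → ∀ x, G W t x) →
      ¬ (∀ r > 0, ∀ M : ℝ, ∃ t ∈ Ioo (-(r ^ 2)) (0 : ℝ),
        ∃ x ∈ ball (0 : EuclideanSpace ℝ (Fin 3)) r, M < ‖W t x‖)) :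
    ∃ ε : ℝ, 0 < ε ∧ ε < 1 ∧ ∃ η : ℝ, 0 < η ∧
      ∀ (V : ℝ → EuclideanSpace ℝ (Fin 3) → EuclideanSpace ℝ (Fin 3)), IsTypeIAncientMild C V →
        (∀ s : ℝ, s < 0 → ∫⁻ x, ‖fderiv ℝ (V s) x‖ₑ ^ 2 ≤ ENNReal.ofReal (K / Real.sqrt (-s))) →
        Q V →
        (∀ r > 0, ∀ M : ℝ, ∃ t ∈ Ioo (-(r ^ 2)) (0 : ℝ),
          ∃ x ∈ ball (0 : EuclideanSpace ℝ (Fin 3)) r, M < ‖V t x‖) →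
        ENNReal.ofReal η ≤
          volume {p : ℝ × EuclideanSpace ℝ (Fin 3) | p.1 ∈ Icc (-1 : ℝ) (-ε) ∧ ¬ G V p.1 p.2} := by
  haveI := isOpenPosMeasure_volume_prod
  by_contra hcon
  push Not at hcon
  -- ## singular members with small windowed violation sets
  have hsmall : ∀ j : ℕ, ∃ u : ℝ → EuclideanSpace ℝ (Fin 3) → EuclideanSpace ℝ (Fin 3),
      IsTypeIAncientMild C u ∧
        (∀ s : ℝ, s < 0 → ∫⁻ x, ‖fderiv ℝ (u s) x‖ₑ ^ 2 ≤ ENNReal.ofReal (K / Real.sqrt (-s))) ∧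
        Q u ∧
        (∀ r > 0, ∀ M : ℝ, ∃ t ∈ Ioo (-(r ^ 2)) (0 : ℝ),
          ∃ x ∈ ball (0 : EuclideanSpace ℝ (Fin 3)) r, M < ‖u t x‖) ∧
        volume {p : ℝ × EuclideanSpace ℝ (Fin 3) |
            p.1 ∈ Icc (-1 : ℝ) (-(1 / ((j : ℝ) + 2))) ∧ ¬ G u p.1 p.2} <
          ENNReal.ofReal (1 / ((j : ℝ) + 2)) := by
    intro j
    obtain ⟨V, hV, hlaw, hQ, hsing, hvol⟩ := hcon (1 / ((j : ℝ) + 2)) (eps_seq_mem j).1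
      (eps_seq_mem j).2 (1 / ((j : ℝ) + 2)) (eps_seq_mem j).1
    exact ⟨V, hV, hlaw, hQ, hsing, hvol⟩
  choose u hu hlaw hQu hsu hvol using hsmall
  obtain ⟨ψ, hψ, W, hW, hunif, hpt, hgr⟩ := Compactness.seqLimit hu
  have hψt : Tendsto ψ atTop atTop := hψ.tendsto_atTop
  have hlawW := dissipationLaw_of_tendsto_fderiv (w := fun j => u (ψ j)) (fun j => hlaw (ψ j)) hgr
  have hQW : Q W := hQclosed (fun j => u (ψ j)) W (fun j => hu (ψ j)) (fun j => hQu (ψ j)) hW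
    hunif hpt hgr
  have hWsing := Compactness.persistent_singularity_seq (w := fun j => u (ψ j))
    (fun j => hu _) (fun j => hlaw _) (fun j => hsu _) hW hunif
  -- ## the limit is violation-free on `(−1, 0) × ℝ³`
  have hgoodW : ∀ t : ℝ, -1 < t → t < 0 → ∀ x, G W t x := by
    intro t₀ h1 ht₀ x₀
    by_contra hbad
    -- an open ball of violations of `W` inside `(−1, 0) × ℝ³`
    have hO := hGopen W hW hQW
    obtain ⟨δ, hδ, hball⟩ := Metric.isOpen_iff.1 hO (t₀, x₀) ⟨ht₀, hbad⟩
    set δ' : ℝ := min δ (min ((t₀ + 1) / 2) (-t₀ / 2)) with hδ'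
    have hδ'pos : 0 < δ' := lt_min hδ (lt_min (by linarith) (by linarith))
    have hδ'δ : δ' ≤ δ := min_le_left _ _
    have hδ'1 : δ' ≤ (t₀ + 1) / 2 := (min_le_right _ _).trans (min_le_left _ _)
    have hδ'2 : δ' ≤ -t₀ / 2 := (min_le_right _ _).trans (min_le_right _ _)
    set B : Set (ℝ × EuclideanSpace ℝ (Fin 3)) := ball (t₀, x₀) δ' with hB
    have hBpos : 0 < volume B := Metric.measure_ball_pos volume _ hδ'pos
    -- every point of `B` is a violation of `W` with time in `(−1, 0)`
    have hBmem : ∀ p ∈ B, (-1 < p.1 ∧ p.1 < 0) ∧ ¬ G W p.1 p.2 := by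
      intro p hp
      have hpδ : dist p (t₀, x₀) < δ' := mem_ball.1 hp
      have hle : dist p.1 t₀ ≤ dist p (t₀, x₀) := by
        rw [Prod.dist_eq]; exact le_max_left _ _
      have ht : dist p.1 t₀ < δ' := lt_of_le_of_lt hle hpδ
      rw [Real.dist_eq] at ht
      have hO' := hball (ball_subset_ball hδ'δ hp)
      refine ⟨⟨?_, ?_⟩, hO'.2⟩
      · have := (abs_lt.1 ht).1; linarith
      · have := (abs_lt.1 ht).2; linarith
    -- `B ⊆ ⋃_N A_N`, `A_N` = «windowed violation of every `u (ψ j)`, `j ≥ N`»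
    set A : ℕ → Set (ℝ × EuclideanSpace ℝ (Fin 3)) := fun N =>
      {p | ∀ j, N ≤ j → p.1 ∈ Icc (-1 : ℝ) (-(1 / ((ψ j : ℝ) + 2))) ∧ ¬ G (u (ψ j)) p.1 p.2} with hA
    have hBsub : B ⊆ ⋃ N, A N := by
      intro p hp
      obtain ⟨⟨hp1, hp2⟩, hpbad⟩ := hBmem p hp
      have hev := hGev (fun j => u (ψ j)) W (fun j => hu _) hW hunif hpt hgr p.1 hp2 p.2 hpbad
      have hev2 : ∀ᶠ j in atTop, (1 : ℝ) / ((ψ j : ℝ) + 2) < -p.1 :=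
        (tendsto_eps_seq hψt).eventually (gt_mem_nhds (neg_pos.2 hp2))
      obtain ⟨N, hN⟩ := eventually_atTop.1 (hev.and hev2)
      refine mem_iUnion.2 ⟨N, fun j hj => ?_⟩
      obtain ⟨hj1, hj2⟩ := hN j hj
      exact ⟨⟨hp1.le, by linarith⟩, hj1⟩
    -- each `A_N` is null
    have hAnull : ∀ N, volume (A N) = 0 := by
      intro N
      by_contra hne
      have hpos : 0 < volume (A N) := pos_iff_ne_zero.2 hne
      have hev3 : ∀ᶠ j in atTop, ENNReal.ofReal (1 / ((ψ j : ℝ) + 2)) < volume (A N) := by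
        have h0 : Tendsto (fun j => ENNReal.ofReal (1 / ((ψ j : ℝ) + 2))) atTop (𝓝 0) := by
          rw [← ENNReal.ofReal_zero]
          exact ENNReal.tendsto_ofReal (tendsto_eps_seq hψt)
        exact h0.eventually (gt_mem_nhds hpos)
      obtain ⟨j, hj1, hj2⟩ := (hev3.and (eventually_ge_atTop N)).exists
      have hsub : A N ⊆ {p : ℝ × EuclideanSpace ℝ (Fin 3) |
          p.1 ∈ Icc (-1 : ℝ) (-(1 / (((ψ j : ℕ) : ℝ) + 2))) ∧ ¬ G (u (ψ j)) p.1 p.2} :=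
        fun p hp => hp j hj2
      have := (measure_mono hsub).trans_lt (hvol (ψ j))
      exact lt_irrefl _ (hj1.trans this)
    have hBnull : volume B = 0 := measure_mono_null hBsub (measure_iUnion_null hAnull)
    exact hBpos.ne' hBnull
  exact hkill W hW hlawW hQW hgoodW hWsing

/-! ### The enveloped frame -/

/-- A Type-I envelope passes to pointwise limits. [folklore] -/
theorem hasTypeIDecay_of_tendsto {A : ℝ}
    {u : ℕ → ℝ → EuclideanSpace ℝ (Fin 3) → EuclideanSpace ℝ (Fin 3)}
    {W : ℝ → EuclideanSpace ℝ (Fin 3) → EuclideanSpace ℝ (Fin 3)} (hdu : ∀ j, HasTypeIDecay A (u j))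
    (hpt : ∀ t < 0, ∀ x, Tendsto (fun j => u j t x) atTop (𝓝 (W t x))) : HasTypeIDecay A W :=
  fun t ht x => le_of_tendsto (hpt t ht x).norm (Eventually.of_forall fun j => hdu j t ht x)

/-- **THE WINDOW SOCKET ON THE ENVELOPED FRAME (point form).** For KNSS-gauge Type-I fields with a
Type-I envelope (constants equalised to `C`; the frame obeys one law `K(C)`): a scale-covariant
pointwise hypothesis whose violations pass from KNSS limits to the approximants and which kills the
apex singularity from `(−1, 0) × ℝ³` is violated by every SINGULAR enveloped field somewhere in every
window `[−c², −εc²] × ℝ³`, one `ε = ε(C) ∈ (0,1)`. [folklore compactness; cite: KochNadirashviliSereginSverak2009, §4 (arXiv:0709.3599 p. 8)] -/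
theorem exists_window_of_apex_kill_envelope
    {G : (ℝ → EuclideanSpace ℝ (Fin 3) → EuclideanSpace ℝ (Fin 3)) → ℝ → EuclideanSpace ℝ (Fin 3) → Prop}
    (hGscale : ∀ (V : ℝ → EuclideanSpace ℝ (Fin 3) → EuclideanSpace ℝ (Fin 3)) (c t : ℝ)
      (x : EuclideanSpace ℝ (Fin 3)), 0 < c → t < 0 → G V (c ^ 2 * t) (c • x) → G (nsRescale c V) t x)
    (hGev : ∀ (u : ℕ → ℝ → EuclideanSpace ℝ (Fin 3) → EuclideanSpace ℝ (Fin 3))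
        (W : ℝ → EuclideanSpace ℝ (Fin 3) → EuclideanSpace ℝ (Fin 3)),
      (∀ j, IsTypeIAncientMild C (u j)) → IsTypeIAncientMild C W →
      (∀ n : ℕ, TendstoUniformlyOn (fun j z => u j z.1 z.2) (fun z => W z.1 z.2) atTop
        (Icc (-((n : ℝ) + 2)) (-(1 / ((n : ℝ) + 2))) ×ˢ
          closedBall (0 : EuclideanSpace ℝ (Fin 3)) ((n : ℝ) + 2))) →
      (∀ t < 0, ∀ x, Tendsto (fun j => u j t x) atTop (𝓝 (W t x))) →
      (∀ t < 0, ∀ x, Tendsto (fun j => fderiv ℝ (u j t) x) atTop (𝓝 (fderiv ℝ (W t) x))) →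
      ∀ t < 0, ∀ x, ¬ G W t x → ∀ᶠ j in atTop, ¬ G (u j) t x)
    (hkill : ∀ (W : ℝ → EuclideanSpace ℝ (Fin 3) → EuclideanSpace ℝ (Fin 3)),
      IsTypeIAncientMild C W → HasTypeIDecay C W → (∀ t : ℝ, -1 < t → t < 0 → ∀ x, G W t x) →
      ¬ (∀ r > 0, ∀ M : ℝ, ∃ t ∈ Ioo (-(r ^ 2)) (0 : ℝ),
        ∃ x ∈ ball (0 : EuclideanSpace ℝ (Fin 3)) r, M < ‖W t x‖)) :
    ∃ ε : ℝ, 0 < ε ∧ ε < 1 ∧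
      ∀ (V : ℝ → EuclideanSpace ℝ (Fin 3) → EuclideanSpace ℝ (Fin 3)), IsTypeIAncientMild C V →
        HasTypeIDecay C V →
        (∀ r > 0, ∀ M : ℝ, ∃ t ∈ Ioo (-(r ^ 2)) (0 : ℝ),
          ∃ x ∈ ball (0 : EuclideanSpace ℝ (Fin 3)) r, M < ‖V t x‖) →
        ∀ c : ℝ, 0 < c → ∃ t ∈ Icc (-c ^ 2) (-(ε * c ^ 2)), ∃ x : EuclideanSpace ℝ (Fin 3), ¬ G V t x := by
  obtain ⟨K, hK⟩ := exists_uniform_law_of_envelope C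
  obtain ⟨ε, hε, hε1, h⟩ := exists_window_of_apex_kill (C := C) (K := K) (Q := HasTypeIDecay C)
    (G := G) (fun V c hc hQ => hQ.nsRescale hc)
    (fun u W _ hQu _ _ hpt _ => hasTypeIDecay_of_tendsto hQu hpt) hGscale hGev
    (fun W hW _ hQW hG => hkill W hW hQW hG)
  exact ⟨ε, hε, hε1, fun V hV hdec hsing c hc => h V hV (hK hV hdec) hdec hsing c hc⟩

/-- **THE WINDOW SOCKET ON THE ENVELOPED FRAME (volume form).** As the point form, plus openness
of the violation set of every enveloped member: there are `ε ∈ (0,1)`, `η > 0` with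
`vol({(t,x) : t ∈ [−1, −ε], ¬ G V t x}) ≥ η` for every SINGULAR enveloped field `V`.
[folklore compactness; cite: KochNadirashviliSereginSverak2009, §4 (arXiv:0709.3599 p. 8)] -/
theorem exists_window_volume_of_apex_kill_envelope
    {G : (ℝ → EuclideanSpace ℝ (Fin 3) → EuclideanSpace ℝ (Fin 3)) → ℝ → EuclideanSpace ℝ (Fin 3) → Prop}
    (hGev : ∀ (u : ℕ → ℝ → EuclideanSpace ℝ (Fin 3) → EuclideanSpace ℝ (Fin 3))
        (W : ℝ → EuclideanSpace ℝ (Fin 3) → EuclideanSpace ℝ (Fin 3)),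
      (∀ j, IsTypeIAncientMild C (u j)) → IsTypeIAncientMild C W →
      (∀ n : ℕ, TendstoUniformlyOn (fun j z => u j z.1 z.2) (fun z => W z.1 z.2) atTop
        (Icc (-((n : ℝ) + 2)) (-(1 / ((n : ℝ) + 2))) ×ˢ
          closedBall (0 : EuclideanSpace ℝ (Fin 3)) ((n : ℝ) + 2))) →
      (∀ t < 0, ∀ x, Tendsto (fun j => u j t x) atTop (𝓝 (W t x))) →
      (∀ t < 0, ∀ x, Tendsto (fun j => fderiv ℝ (u j t) x) atTop (𝓝 (fderiv ℝ (W t) x))) →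
      ∀ t < 0, ∀ x, ¬ G W t x → ∀ᶠ j in atTop, ¬ G (u j) t x)
    (hGopen : ∀ (U : ℝ → EuclideanSpace ℝ (Fin 3) → EuclideanSpace ℝ (Fin 3)),
      IsTypeIAncientMild C U → HasTypeIDecay C U →
      IsOpen {p : ℝ × EuclideanSpace ℝ (Fin 3) | p.1 < 0 ∧ ¬ G U p.1 p.2})
    (hkill : ∀ (W : ℝ → EuclideanSpace ℝ (Fin 3) → EuclideanSpace ℝ (Fin 3)),
      IsTypeIAncientMild C W → HasTypeIDecay C W → (∀ t : ℝ, -1 < t → t < 0 → ∀ x, G W t x) →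
      ¬ (∀ r > 0, ∀ M : ℝ, ∃ t ∈ Ioo (-(r ^ 2)) (0 : ℝ),
        ∃ x ∈ ball (0 : EuclideanSpace ℝ (Fin 3)) r, M < ‖W t x‖)) :
    ∃ ε : ℝ, 0 < ε ∧ ε < 1 ∧ ∃ η : ℝ, 0 < η ∧
      ∀ (V : ℝ → EuclideanSpace ℝ (Fin 3) → EuclideanSpace ℝ (Fin 3)), IsTypeIAncientMild C V →
        HasTypeIDecay C V →
        (∀ r > 0, ∀ M : ℝ, ∃ t ∈ Ioo (-(r ^ 2)) (0 : ℝ),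
          ∃ x ∈ ball (0 : EuclideanSpace ℝ (Fin 3)) r, M < ‖V t x‖) →
        ENNReal.ofReal η ≤
          volume {p : ℝ × EuclideanSpace ℝ (Fin 3) | p.1 ∈ Icc (-1 : ℝ) (-ε) ∧ ¬ G V p.1 p.2} := by
  obtain ⟨K, hK⟩ := exists_uniform_law_of_envelope C
  obtain ⟨ε, hε, hε1, η, hη, h⟩ := exists_window_volume_of_apex_kill (C := C) (K := K)
    (Q := HasTypeIDecay C) (G := G)
    (fun u W _ hQu _ _ hpt _ => hasTypeIDecay_of_tendsto hQu hpt) hGev hGopen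
    (fun W hW _ hQW hG => hkill W hW hQW hG)
  exact ⟨ε, hε, hε1, η, hη, fun V hV hdec hsing => h V hV (hK hV hdec) hdec hsing⟩

end Summit.NavierStokesRegularity.NavierStokesRegularity.Theorems.FiniteDissipationLiouville.WindowSocket

end
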